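import Summits.QuantumFields.YangMills.Theorems.PencilRigidityCurvatureKernelBoundChartDerivativeBoundsCore
import Summits.QuantumFields.YangMills.Theorems.PencilRigidityCurvatureKernelBoundKernelOffDiagonalFrames
import Summits.QuantumFields.YangMills.Theorems.MirrorModularBoostsPlanarSpectralCone
import Summits.QuantumFields.YangMills.Theorems.CurvatureBoostCovariance.Negative.Unbundled
import Summits.QuantumFields.YangMills.Theorems.NPointIsotropy.Negative.HyperoctahedralPlane

/-!
# Three-point chart bounds I: the spatial semigroup derivative bound under the planar spectral cone

Support file for stub `stub_threePointChartBounds` (B) of reshape 4 of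
`Cruxes/TemperedCurvatureMoments/Lines/Sketch.lean` (crux stmt-QuantumFields-17721, line `Sketch`).
The spatial companion of `CurvatureKernel.norm_iterDeriv_inner_transfer_le`: for `h : OSReconstructionNoE1 S`
on `ℝ⁴` whose joint spectral measures are carried by the closed planar cone `{|p₁| ≤ p₀}`, every chain
`G 0 b = ⟪ψ₁, e^{-tH} U(b e₁) ψ₂⟫`, `Gⱼ' = Gⱼ₊₁` obeys `‖G N b‖ ≤ (N/(e t))ᴺ (‖ψ₁‖² + ‖ψ₂‖²)`
(polarisation, Fourier–Laplace moments `∫ (i p₁)ʲ e^{−tp₀+ibp₁} dμ` of the four joint spectral measures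
differentiated under the integral, dominated on the cone by `p₀ʲ e^{−tp₀} ≤ (j/(et))ʲ`).
References: Osterwalder–Schrader, Comm. Math. Phys. 31 (1973) §4.1, 42 (1975) §4; Glimm–Jaffe, Quantum
Physics (1987) Thm. 6.1.3, §19.5. [folklore]
-/

noncomputable section

open scoped InnerProductSpace ComplexConjugate
open MeasureTheory Filter Set Complex
open _root_.Topology
open Literature.MathematicalPhysics.AQFT Literature.MathematicalPhysics.QuantumLattice
open Literature.MathematicalPhysics.QuantumFieldTheory
open Summit.QuantumFields.YangMills.Theorems.CurvatureKernel (pow_mul_exp_neg_mul_le)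

namespace Summit.QuantumFields.YangMills.Theorems.TemperedCurvatureMoments.Sketch.ThreePointChartBounds

/-! ## Fourier–Laplace moments of a finite measure on the planar cone -/

section Moments

variable {μ : Measure (EuclideanSpace ℝ (Fin 4))}

/-- A measure carried by `{p₀ ≥ 0}` and by the closed planar cone has `0 ≤ p₀` and `|p₁| ≤ p₀` almost
everywhere. [folklore] -/
theorem ae_cone (h0 : μ {p | p 0 < 0} = 0) (hc : μ {p | p 0 < |p 1|} = 0) :
    ∀ᵐ p ∂μ, 0 ≤ p 0 ∧ |p 1| ≤ p 0 := by
  rw [measure_eq_zero_iff_ae_notMem] at h0 hc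
  filter_upwards [h0, hc] with p hp hp'
  simp only [not_lt] at hp hp'
  exact ⟨hp, hp'⟩

/-- The integrand is continuous in `p`. [folklore] -/
theorem continuous_flIntegrand (t : ℝ) (j : ℕ) (b : ℝ) :
    Continuous fun p : EuclideanSpace ℝ (Fin 4) => (((p 1 : ℂ) * I) ^ j * cexp ((((-(t * p 0)) : ℝ) : ℂ) + (((b * p 1) : ℝ) : ℂ) * I)) := by
  have h0 : Continuous fun p : EuclideanSpace ℝ (Fin 4) => p 0 := PiLp.continuous_apply 2 _ 0
  have h1 : Continuous fun p : EuclideanSpace ℝ (Fin 4) => p 1 := PiLp.continuous_apply 2 _ 1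
  fun_prop

/-- `‖(i p₁)ʲ e^{−tp₀ + ibp₁}‖ = |p₁|ʲ e^{−tp₀}`. [folklore] -/
theorem norm_flIntegrand (t : ℝ) (j : ℕ) (b : ℝ) (p : EuclideanSpace ℝ (Fin 4)) :
    ‖(((p 1 : ℂ) * I) ^ j * cexp ((((-(t * p 0)) : ℝ) : ℂ) + (((b * p 1) : ℝ) : ℂ) * I))‖ = |p 1| ^ j * Real.exp (-(t * p 0)) := by
  rw [norm_mul, norm_pow, norm_mul, Complex.norm_I, mul_one, Complex.norm_real, Real.norm_eq_abs,
    Complex.norm_exp]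
  congr 1
  simp

/-- On the cone the integrand is bounded: `|p₁|ʲ e^{−tp₀} ≤ (j/(e t))ʲ` for `0 ≤ p₀`, `|p₁| ≤ p₀`,
`t > 0`. [folklore] -/
theorem norm_flIntegrand_le {p : EuclideanSpace ℝ (Fin 4)} (hp : 0 ≤ p 0 ∧ |p 1| ≤ p 0) (j : ℕ) (b : ℝ)
    {t : ℝ} (ht : 0 < t) :
    ‖(((p 1 : ℂ) * I) ^ j * cexp ((((-(t * p 0)) : ℝ) : ℂ) + (((b * p 1) : ℝ) : ℂ) * I))‖ ≤ (j / (Real.exp 1 * t)) ^ j := by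
  rw [norm_flIntegrand]
  calc |p 1| ^ j * Real.exp (-(t * p 0)) ≤ p 0 ^ j * Real.exp (-(t * p 0)) := by
        gcongr
        exact hp.2
    _ ≤ (j / (Real.exp 1 * t)) ^ j := pow_mul_exp_neg_mul_le hp.1 ht j

/-- The Fourier–Laplace moments are integrable. [folklore] -/
theorem integrable_flIntegrand [IsFiniteMeasure μ] (h0 : μ {p | p 0 < 0} = 0)
    (hc : μ {p | p 0 < |p 1|} = 0) (j : ℕ) (b : ℝ) {t : ℝ} (ht : 0 < t) :
    Integrable (fun p => (((p 1 : ℂ) * I) ^ j * cexp ((((-(t * p 0)) : ℝ) : ℂ) + (((b * p 1) : ℝ) : ℂ) * I))) μ := by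
  refine Integrable.of_bound (continuous_flIntegrand t j b).aestronglyMeasurable
    ((j / (Real.exp 1 * t)) ^ j) ?_
  filter_upwards [ae_cone h0 hc] with p hp
  exact norm_flIntegrand_le hp j b ht

/-- **`|∫ (i p₁)ʲ e^{−tp₀ + ibp₁} dμ| ≤ (j/(e t))ʲ μ(univ)`.** [folklore] -/
theorem norm_flMoment_le [IsFiniteMeasure μ] (h0 : μ {p | p 0 < 0} = 0)
    (hc : μ {p | p 0 < |p 1|} = 0) (j : ℕ) (b : ℝ) {t : ℝ} (ht : 0 < t) :
    ‖∫ p, (((p 1 : ℂ) * I) ^ j * cexp ((((-(t * p 0)) : ℝ) : ℂ) + (((b * p 1) : ℝ) : ℂ) * I)) ∂μ‖ ≤ (j / (Real.exp 1 * t)) ^ j * μ.real univ := by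
  refine norm_integral_le_of_norm_le_const ?_
  filter_upwards [ae_cone h0 hc] with p hp
  exact norm_flIntegrand_le hp j b ht

/-- The integrand is differentiable in `b` with derivative the next integrand. [folklore] -/
theorem hasDerivAt_flIntegrand (t : ℝ) (j : ℕ) (b : ℝ) (p : EuclideanSpace ℝ (Fin 4)) :
    HasDerivAt (fun β : ℝ => (((p 1 : ℂ) * I) ^ j * cexp ((((-(t * p 0)) : ℝ) : ℂ) + (((β * p 1) : ℝ) : ℂ) * I))) ((((p 1 : ℂ) * I) ^ (j + 1) * cexp ((((-(t * p 0)) : ℝ) : ℂ) + (((b * p 1) : ℝ) : ℂ) * I))) b := by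
  have h1 : HasDerivAt (fun β : ℝ => ((((β * p 1) : ℝ)) : ℂ)) ((p 1 : ℝ) : ℂ) b := by
    have := ((hasDerivAt_id b).mul_const (p 1)).ofReal_comp
    simpa using this
  have h2 : HasDerivAt (fun β : ℝ => (((-(t * p 0)) : ℝ) : ℂ) + ((((β * p 1) : ℝ)) : ℂ) * I)
      (((p 1 : ℝ) : ℂ) * I) b := by
    simpa using (h1.mul_const I).const_add ((((-(t * p 0)) : ℝ) : ℂ))
  have h3 := (h2.cexp).const_mul (((p 1 : ℂ) * I) ^ j)
  have heq : ((p 1 : ℂ) * I) ^ j * (cexp ((((-(t * p 0)) : ℝ) : ℂ) + ((((b * p 1) : ℝ)) : ℂ) * I) *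
      (((p 1 : ℝ) : ℂ) * I)) =
      ((p 1 : ℂ) * I) ^ (j + 1) * cexp ((((-(t * p 0)) : ℝ) : ℂ) + ((((b * p 1) : ℝ)) : ℂ) * I) := by
    rw [pow_succ]; ring
  rw [heq] at h3
  exact h3

/-- **Differentiation under the integral**: `d/db ∫ (i p₁)ʲ e^{−tp₀+ibp₁} dμ = ∫ (i p₁)ʲ⁺¹ e^{−tp₀+ibp₁} dμ`
(`t > 0`, dominated on the cone by the constant `((j+1)/(et))ʲ⁺¹`). [folklore] -/
theorem hasDerivAt_flMoment [IsFiniteMeasure μ] (h0 : μ {p | p 0 < 0} = 0)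
    (hc : μ {p | p 0 < |p 1|} = 0) (j : ℕ) {t : ℝ} (ht : 0 < t) (b : ℝ) :
    HasDerivAt (fun β : ℝ => ∫ p, (((p 1 : ℂ) * I) ^ j * cexp ((((-(t * p 0)) : ℝ) : ℂ) + (((β * p 1) : ℝ) : ℂ) * I)) ∂μ) (∫ p, (((p 1 : ℂ) * I) ^ (j + 1) * cexp ((((-(t * p 0)) : ℝ) : ℂ) + (((b * p 1) : ℝ) : ℂ) * I)) ∂μ) b := by
  have h := hasDerivAt_integral_of_dominated_loc_of_deriv_le (μ := μ) (x₀ := b)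
    (F := fun β p => (((p 1 : ℂ) * I) ^ j * cexp ((((-(t * p 0)) : ℝ) : ℂ) + (((β * p 1) : ℝ) : ℂ) * I))) (F' := fun β p => (((p 1 : ℂ) * I) ^ (j + 1) * cexp ((((-(t * p 0)) : ℝ) : ℂ) + (((β * p 1) : ℝ) : ℂ) * I)))
    (bound := fun _ => ((j + 1 : ℕ) / (Real.exp 1 * t)) ^ (j + 1)) univ_mem
    (Eventually.of_forall fun β => (continuous_flIntegrand t j β).aestronglyMeasurable)
    (integrable_flIntegrand h0 hc j b ht)
    (continuous_flIntegrand t (j + 1) b).aestronglyMeasurable ?_ (integrable_const _) ?_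
  · exact h.2
  · filter_upwards [ae_cone h0 hc] with p hp β _
    exact norm_flIntegrand_le hp (j + 1) β ht
  · exact Eventually.of_forall fun p β _ => hasDerivAt_flIntegrand t j β p

end Moments

/-! ## The OS Hilbert space: spectral representation of `⟪ψ, e^{-tH} U(b e₁) ψ⟫` and polarisation -/

section Hilbert

universe u

variable {ι : Type u} {S : LabelledSchwingerFamily ι (EuclideanSpace ℝ (Fin 4))} (h : OSReconstructionNoE1 S)

/-- `⟪b e₁, p⟫ = b p₁`. [folklore] -/
theorem inner_smul_single_one_eq (b : ℝ) (p : EuclideanSpace ℝ (Fin 4)) :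
    ⟪b • EuclideanSpace.single (1 : Fin 4) (1 : ℝ), p⟫_ℝ = b * p 1 := by
  simp [real_inner_smul_left, EuclideanSpace.inner_single_left]

/-- **Spectral representation of the diagonal**: `⟪u, e^{-tH} U(b e₁) u⟫ = ∫ e^{−tp₀ + ibp₁} dμ_u` for the
joint spectral measure `μ_u`. [folklore] -/
theorem inner_transfer_translate_eq_flMoment (u : h.Hilbert) {t : ℝ} (ht : 0 ≤ t) (b : ℝ) :
    ⟪u, h.transfer t (h.translate (b • EuclideanSpace.single (1 : Fin 4) (1 : ℝ)) u)⟫_ℂ =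
      ∫ p, (((p 1 : ℂ) * I) ^ 0 * cexp ((((-(t * p 0)) : ℝ) : ℂ) + (((b * p 1) : ℝ) : ℂ) * I)) ∂(h.jointSpectralMeasure u) := by
  have hμ := h.isJointSpectralMeasure_of_exists
    OSReconstructionNoE1.exists_isJointSpectralMeasure_holds u
  rw [hμ.inner_transfer_translate t ht (b • EuclideanSpace.single (1 : Fin 4) (1 : ℝ)) (by simp)]
  refine integral_congr_ae (Eventually.of_forall fun p => ?_)
  simp only [pow_zero, one_mul, inner_smul_single_one_eq]

/-- **Polarisation** of `⟪ψ₁, e^{-tH} U(a) ψ₂⟫` into four diagonal terms. [folklore] -/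
theorem inner_transfer_translate_polarization (ψ₁ ψ₂ : h.Hilbert) (t : ℝ) (a : EuclideanSpace ℝ (Fin 4)) :
    ⟪ψ₁, h.transfer t (h.translate a ψ₂)⟫_ℂ =
      (⟪ψ₁ + ψ₂, h.transfer t (h.translate a (ψ₁ + ψ₂))⟫_ℂ -
          ⟪ψ₁ - ψ₂, h.transfer t (h.translate a (ψ₁ - ψ₂))⟫_ℂ -
          Complex.I * ⟪ψ₁ + Complex.I • ψ₂, h.transfer t (h.translate a (ψ₁ + Complex.I • ψ₂))⟫_ℂ +
        Complex.I * ⟪ψ₁ - Complex.I • ψ₂, h.transfer t (h.translate a (ψ₁ - Complex.I • ψ₂))⟫_ℂ) / 4 := by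
  set T : h.Hilbert →ₗ[ℂ] h.Hilbert :=
    ((h.transfer t : h.Hilbert →L[ℂ] h.Hilbert) : h.Hilbert →ₗ[ℂ] h.Hilbert).comp
      (h.translate a).toLinearEquiv.toLinearMap with hT
  have hTa : ∀ ψ, T ψ = h.transfer t (h.translate a ψ) := fun ψ => rfl
  have hp := inner_map_polarization T ψ₁ ψ₂
  simp only [hTa] at hp
  rw [← inner_conj_symm, hp]
  simp only [map_div₀, map_sub, map_add, map_mul, Complex.conj_I, inner_conj_symm, map_ofNat]
  ring

/-- **The spatial semigroup derivative bound on the planar cone.**  If every joint spectral measure of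
`h` is carried by the closed planar cone `{|p₁| ≤ p₀}`, `t > 0`, and `G : ℕ → ℝ → ℂ` satisfies
`G 0 b = ⟪ψ₁, e^{-tH} U(b e₁) ψ₂⟫` for all real `b` and `Gⱼ' = Gⱼ₊₁` everywhere, then
`‖G N b‖ ≤ (N/(e t))ᴺ (‖ψ₁‖² + ‖ψ₂‖²)` — the generator-free form of `‖P₁ᴺ e^{-tH}‖ ≤ ‖Hᴺ e^{-tH}‖ ≤ (N/(et))ᴺ`
on the cone `|P₁| ≤ H`. [folklore] -/
theorem norm_iterDeriv_inner_transfer_translate_le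
    (hcone : ∀ (ψ : h.Hilbert) (μ : Measure (EuclideanSpace ℝ (Fin 4))),
      h.IsJointSpectralMeasure ψ μ → μ {p | p 0 < |p 1|} = 0)
    (ψ₁ ψ₂ : h.Hilbert) {t : ℝ} (ht : 0 < t) (G : ℕ → ℝ → ℂ)
    (hG0 : ∀ b : ℝ, G 0 b = ⟪ψ₁, h.transfer t (h.translate (b • EuclideanSpace.single (1 : Fin 4) (1 : ℝ)) ψ₂)⟫_ℂ)
    (hd : ∀ (j : ℕ) (b : ℝ), HasDerivAt (G j) (G (j + 1) b) b) (N : ℕ) (b : ℝ) :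
    ‖G N b‖ ≤ (N / (Real.exp 1 * t)) ^ N * (‖ψ₁‖ ^ 2 + ‖ψ₂‖ ^ 2) := by
  -- the four polarisation vectors, coefficients and joint spectral measures
  set u : Fin 4 → h.Hilbert := ![ψ₁ + ψ₂, ψ₁ - ψ₂, ψ₁ + Complex.I • ψ₂, ψ₁ - Complex.I • ψ₂] with hu
  set c : Fin 4 → ℂ := ![1 / 4, -(1 / 4), -(Complex.I / 4), Complex.I / 4] with hc
  have hμ : ∀ k, h.IsJointSpectralMeasure (u k) (h.jointSpectralMeasure (u k)) := fun k =>
    h.isJointSpectralMeasure_of_exists OSReconstructionNoE1.exists_isJointSpectralMeasure_holds (u k)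
  haveI : ∀ k, IsFiniteMeasure (h.jointSpectralMeasure (u k)) := fun k => (hμ k).isFiniteMeasure
  have hck : ∀ k, (h.jointSpectralMeasure (u k)) {p | p 0 < |p 1|} = 0 := fun k => hcone _ _ (hμ k)
  -- the Fourier–Laplace moments and their combination
  set L : Fin 4 → ℕ → ℝ → ℂ := fun k j β =>
    ∫ p, (((p 1 : ℂ) * I) ^ j * cexp ((((-(t * p 0)) : ℝ) : ℂ) + (((β * p 1) : ℝ) : ℂ) * I)) ∂(h.jointSpectralMeasure (u k)) with hL
  set P : ℕ → ℝ → ℂ := fun j β => ∑ k, c k * L k j β with hP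
  -- (i) `G 0 = P 0`
  have hP0 : ∀ β : ℝ, G 0 β = P 0 β := by
    intro β
    rw [hG0 β, inner_transfer_translate_polarization, hP]
    simp only [Fin.sum_univ_four, hc, hu, hL, Matrix.cons_val_zero, Matrix.cons_val_one,
      Matrix.cons_val, ← inner_transfer_translate_eq_flMoment h _ ht.le]
    ring
  -- (ii) `Pⱼ' = Pⱼ₊₁`
  have hPd : ∀ (j : ℕ) (β : ℝ), HasDerivAt (P j) (P (j + 1) β) β := by
    intro j β
    have hk : ∀ k ∈ (Finset.univ : Finset (Fin 4)),
        HasDerivAt (fun σ : ℝ => c k * L k j σ) (c k * L k (j + 1) β) β := fun k _ =>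
      (hasDerivAt_flMoment (hμ k).energy_nonneg (hck k) j ht β).const_mul (c k)
    have := HasDerivAt.fun_sum hk
    simpa [hP] using this
  -- (iii) identification of the derivatives by induction
  have hGP : ∀ (j : ℕ) (β : ℝ), G j β = P j β := by
    intro j
    induction j with
    | zero => exact hP0
    | succ j ih =>
      intro β
      have hev : G j =ᶠ[𝓝 β] P j := Eventually.of_forall ih
      exact (hd j β).unique ((hPd j β).congr_of_eventuallyEq hev)
  -- (iv) the bound
  rw [hGP N b]
  have hLk : ∀ k, ‖L k N b‖ ≤ (N / (Real.exp 1 * t)) ^ N * ‖u k‖ ^ 2 := by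
    intro k
    rw [← (hμ k).measureReal_univ h]
    exact norm_flMoment_le (hμ k).energy_nonneg (hck k) N b ht
  have hcn : ∀ k, ‖c k‖ = 1 / 4 := by
    intro k
    fin_cases k <;> simp [hc]
  calc ‖P N b‖ ≤ ∑ k, ‖c k * L k N b‖ := norm_sum_le _ _
    _ ≤ ∑ k, 1 / 4 * ((N / (Real.exp 1 * t)) ^ N * ‖u k‖ ^ 2) :=
        Finset.sum_le_sum fun k _ => by
          rw [norm_mul, hcn]
          exact mul_le_mul_of_nonneg_left (hLk k) (by norm_num)
    _ = (N / (Real.exp 1 * t)) ^ N * (1 / 4 * ∑ k, ‖u k‖ ^ 2) := by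
        rw [← Finset.mul_sum, ← Finset.mul_sum]; ring
    _ = (N / (Real.exp 1 * t)) ^ N * (‖ψ₁‖ ^ 2 + ‖ψ₂‖ ^ 2) := by
        congr 1
        simp only [Fin.sum_univ_four, hu, Matrix.cons_val_zero, Matrix.cons_val_one, Matrix.cons_val]
        have p1 := parallelogram_law_with_norm ℂ ψ₁ ψ₂
        have p2 := parallelogram_law_with_norm ℂ ψ₁ (Complex.I • ψ₂)
        rw [norm_smul, Complex.norm_I, one_mul] at p2
        linarith

end Hilbert

end Summit.QuantumFields.YangMills.Theorems.TemperedCurvatureMoments.Sketch.ThreePointChartBounds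

end
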